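import Literature.AnabelianGeometry.Anabelioids.Basic
import Mathlib.CategoryTheory.Galois.Examples
import Mathlib.CategoryTheory.Limits.FullSubcategory
import Mathlib.CategoryTheory.Limits.FintypeCat
import Mathlib.CategoryTheory.Limits.Constructions.EpiMono
import HarnessLib

/-!
# Anabelioids: proofs of named facts of `Anabelioids/Basic.lean` — `B(G)` is a Galois category

Mochizuki, *The geometry of anabelioids*, Publ. RIMS **40** (2004), §1.1 p. 9
[cite: MochizukiGeoAn2004, §1.1 p.9]: "`B(G)` … forms a rather special kind of topos called a
Galois category"; [SemiAnbd] §0 p. 6: "Thus, `B(G)` is a Galois category, or, in the terminology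
of [Mzk4], a connected anabelioid".  The statement file
`Literature.AnabelianGeometry.Anabelioids.Basic` records this as the named fact
`bCat_galoisCategory` (for profinite `G`); this proof-only companion discharges it, in fact for
an arbitrary topological group `G` (`galoisCategory_bCat`):

* the continuity predicate `Action.IsContinuous` on finite `G`-sets (Mathlib: `B(G)` is the full
  subcategory `ContAction FintypeCat G` of `Action FintypeCat G` on it) says that all stabilisers
  are open (`continuousSMul_iff_stabilizer_isOpen`); it is closed under finite limits (a limit
  cone is jointly injective on points, so a stabiliser contains the finite intersection of the
  stabilisers of the projections), under finite colimits (a colimit cocone is jointly surjective,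
  and stabilisers grow along equivariant maps) and under equivariant injections;
* hence the axioms (G1)–(G3) of a Galois category and the fibre-functor axioms (G4)–(G6) for the
  forgetful functor transfer from Mathlib's `GaloisCategory (Action FintypeCat G)` (the case of a
  discrete group) to the full subcategory, quotients by finite groups of automorphisms being
  transported along `MulEquiv.toSingleObjEquiv` to a universe-`0` copy of the group.

Proof-only: no definitions, nothing of the statement file is restated.
-/

namespace Literature.AnabelianGeometry.Anabelioids

open CategoryTheory CategoryTheory.Limits CategoryTheory.PreGaloisCategory
open Literature.AlgebraicGeometry.Frobenioids (BCat)
open scoped FintypeCatDiscrete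

universe u

section Continuity

variable {G : Type u} [Group G] [TopologicalSpace G] [IsTopologicalGroup G]

/-- A finite `G`-set is continuous iff every stabiliser is open (Mathlib's
`continuousSMul_iff_stabilizer_isOpen`, transported along the definitional identification of
`Action.IsContinuous X` with `ContinuousSMul G X.V` for the discrete topology). [folklore] -/
private theorem isContinuous_iff (X : Action FintypeCat.{u} G) :
    Action.IsContinuous X ↔ ∀ x : X.V, IsOpen (MulAction.stabilizer G x : Set G) := by
  constructor
  · intro h
    have h' : ContinuousSMul G X.V := h
    exact continuousSMul_iff_stabilizer_isOpen.mp h'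
  · intro h
    have h' : ContinuousSMul G X.V := continuousSMul_iff_stabilizer_isOpen.mpr h
    exact h'

omit [TopologicalSpace G] [IsTopologicalGroup G] in
/-- Equivariance of a morphism of finite `G`-sets, pointwise. [folklore] -/
private theorem hom_smul {X Y : Action FintypeCat.{u} G} (f : X ⟶ Y) (g : G) (x : X.V) :
    f.hom (g • x) = g • f.hom x := by
  have e := ConcreteCategory.congr_hom (f.comm g) x
  simp only [FintypeCat.comp_apply] at e
  exact e

/-- Continuity pulls back along equivariant injections: the stabiliser of `z` contains the
(open) stabiliser of its image. [folklore] -/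
private theorem isContinuous_of_injective {X Z : Action FintypeCat.{u} G} (i : Z ⟶ X)
    (hi : Function.Injective fun z : Z.V => (i.hom z : X.V)) (hX : Action.IsContinuous X) :
    Action.IsContinuous Z := by
  rw [isContinuous_iff] at hX ⊢
  intro z
  have hle : MulAction.stabilizer G (i.hom z : X.V) ≤ MulAction.stabilizer G z := by
    intro g hg
    rw [MulAction.mem_stabilizer_iff] at hg ⊢
    apply hi
    change i.hom (g • z) = i.hom z
    rw [hom_smul, hg]
  exact Subgroup.isOpen_mono hle (hX _)

/-- Continuity is closed under finite limits of finite `G`-sets: a limit cone is jointly injective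
on points, so the stabiliser of a point contains the finite intersection of the (open)
stabilisers of its projections. [folklore] -/
private theorem isContinuous_of_isLimit {J : Type} [SmallCategory J] [FinCategory J]
    {K : J ⥤ Action FintypeCat.{u} G} {c : Cone K} (hc : IsLimit c)
    (hK : ∀ j, Action.IsContinuous (K.obj j)) : Action.IsContinuous c.pt := by
  rw [isContinuous_iff]
  intro x
  -- the cone is jointly injective on points
  have hc' := isLimitOfPreserves (forget (Action FintypeCat.{u} G)) hc
  have hinj : ∀ y y' : c.pt.V,
      (∀ j, (c.π.app j).hom y = (c.π.app j).hom y') → y = y' := by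
    intro y y' h
    apply (Types.isLimitEquivSections hc').injective
    apply Subtype.ext
    funext j
    exact h j
  have hle : (⨅ j, MulAction.stabilizer G ((c.π.app j).hom x : (K.obj j).V)) ≤
      MulAction.stabilizer G x := by
    intro g hg
    rw [Subgroup.mem_iInf] at hg
    rw [MulAction.mem_stabilizer_iff]
    apply hinj
    intro j
    have e := hom_smul (c.π.app j) g x
    exact e.trans (MulAction.mem_stabilizer_iff.mp (hg j))
  have hopen : IsOpen ((⨅ j, MulAction.stabilizer G ((c.π.app j).hom x : (K.obj j).V) :
      Subgroup G) : Set G) := by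
    rw [Subgroup.coe_iInf]
    exact isOpen_iInter_of_finite fun j => (isContinuous_iff (K.obj j)).mp (hK j) _
  exact Subgroup.isOpen_mono hle hopen

/-- Continuity is closed under finite colimits of finite `G`-sets: a colimit cocone is jointly
surjective on points, and stabilisers grow along equivariant maps. [folklore] -/
private theorem isContinuous_of_isColimit {J : Type} [SmallCategory J] [FinCategory J]
    {K : J ⥤ Action FintypeCat.{u} G} {c : Cocone K} (hc : IsColimit c)
    (hK : ∀ j, Action.IsContinuous (K.obj j)) : Action.IsContinuous c.pt := by
  rw [isContinuous_iff]
  intro x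
  obtain ⟨j, (y : (K.obj j).V), rfl⟩ :=
    FintypeCat.jointly_surjective (K ⋙ Action.forget FintypeCat.{u} G)
      ((Action.forget FintypeCat.{u} G).mapCocone c) (isColimitOfPreserves _ hc) x
  have hle : MulAction.stabilizer G (y : (K.obj j).V) ≤
      MulAction.stabilizer G ((c.ι.app j).hom y : c.pt.V) := by
    intro g hg
    rw [MulAction.mem_stabilizer_iff] at hg ⊢
    have e := hom_smul (c.ι.app j) g y
    rw [hg] at e
    exact e.symm
  exact Subgroup.isOpen_mono hle ((isContinuous_iff (K.obj j)).mp (hK j) y)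

end Continuity

/-- For ANY topological group `G`, finite sets with continuous `G`-action form a Galois category
(with fibre functor the forgetful functor): the axioms transfer from Mathlib's
`GaloisCategory (Action FintypeCat G)` to the full subcategory `B(G) = ContAction FintypeCat G`,
continuity being closed under finite limits, finite colimits and passage to complements of
monomorphisms. [cite: MochizukiGeoAn2004, §1.1 p.9] -/
theorem galoisCategory_bCat (G : Type u) [Group G] [TopologicalSpace G] [IsTopologicalGroup G] :
    GaloisCategory (BCat G) := by
  -- closure of continuity under finite (co)limits, as local instances
  haveI hlim : ∀ (J : Type) [SmallCategory J] [FinCategory J],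
      ObjectProperty.IsClosedUnderLimitsOfShape
        (Action.IsContinuous (V := FintypeCat.{u}) (G := G)) J :=
    fun J _ _ => ⟨fun X hX => by
      obtain ⟨h⟩ := hX
      exact isContinuous_of_isLimit h.isLimit h.prop_diag_obj⟩
  haveI hcolim : ∀ (J : Type) [SmallCategory J] [FinCategory J],
      ObjectProperty.IsClosedUnderColimitsOfShape
        (Action.IsContinuous (V := FintypeCat.{u}) (G := G)) J :=
    fun J _ _ => ⟨fun X hX => by
      obtain ⟨h⟩ := hX
      exact isContinuous_of_isColimit h.isColimit h.prop_diag_obj⟩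
  haveI : ∀ (J : Type) [SmallCategory J] [FinCategory J], HasLimitsOfShape J (BCat G) :=
    fun J _ _ => hasLimitsOfShape_of_closedUnderLimits J _
  haveI : ∀ (J : Type) [SmallCategory J] [FinCategory J], HasColimitsOfShape J (BCat G) :=
    fun J _ _ => hasColimitsOfShape_of_closedUnderColimits J _
  -- (G1)–(G3)
  haveI hpre : PreGaloisCategory (BCat G) :=
    { hasTerminal := inferInstance
      hasPullbacks := inferInstance
      hasFiniteCoproducts := ⟨fun _ => inferInstance⟩
      hasQuotientsByFiniteGroups := fun H _ _ => by
        obtain ⟨H', _, _, ⟨e⟩⟩ :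
            ∃ (H' : Type) (_ : Group H') (_ : Fintype H'), Nonempty (H ≃* H') :=
          Finite.exists_type_univ_nonempty_mulEquiv H
        exact hasColimitsOfShape_of_equivalence e.toSingleObjEquiv.symm
      monoInducesIsoOnDirectSummand := fun {X Y} i _ => by
        haveI : Mono i.hom :=
          (ObjectProperty.ι (Action.IsContinuous (V := FintypeCat.{u}) (G := G))).map_mono i
        haveI : Mono ((forget (Action FintypeCat.{u} G)).map i.hom) :=
          (forget (Action FintypeCat.{u} G)).map_mono i.hom
        have hZ : Action.IsContinuous (FintypeCat.Action.imageComplement G i.hom) :=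
          isContinuous_of_injective (FintypeCat.Action.imageComplementIncl G i.hom)
            Subtype.val_injective Y.property
        have hcA : IsColimit (BinaryCofan.mk i.hom (FintypeCat.Action.imageComplementIncl G i.hom)) :=
          isColimitOfReflects (Action.forget _ _ ⋙ FintypeCat.incl) <|
            (isColimitMapCoconeBinaryCofanEquiv (forget _) i.hom _).symm
              (Types.isCoprodOfMono ((forget _).map i.hom))
        refine ⟨⟨FintypeCat.Action.imageComplement G i.hom, hZ⟩,
          ObjectProperty.homMk (FintypeCat.Action.imageComplementIncl G i.hom), ⟨?_⟩⟩
        exact isColimitOfReflects (ObjectProperty.ι _)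
          ((isColimitMapCoconeBinaryCofanEquiv (ObjectProperty.ι _) i _).symm hcA) }
  -- (G4)–(G6) for the forgetful functor
  haveI : ∀ (J : Type) [SmallCategory J] [FinCategory J], PreservesLimitsOfShape J
      (ObjectProperty.ι (Action.IsContinuous (V := FintypeCat.{u}) (G := G)) ⋙
        Action.forget FintypeCat.{u} G) :=
    fun J _ _ => inferInstance
  haveI : ∀ (J : Type) [SmallCategory J] [FinCategory J], PreservesColimitsOfShape J
      (ObjectProperty.ι (Action.IsContinuous (V := FintypeCat.{u}) (G := G)) ⋙
        Action.forget FintypeCat.{u} G) :=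
    fun J _ _ => inferInstance
  have hF : FiberFunctor
      (ObjectProperty.ι (Action.IsContinuous (V := FintypeCat.{u}) (G := G)) ⋙
        Action.forget FintypeCat.{u} G) :=
    { preservesTerminalObjects := inferInstance
      preservesPullbacks := inferInstance
      preservesFiniteCoproducts := ⟨fun _ => inferInstance⟩
      preservesEpis := inferInstance
      preservesQuotientsByFiniteGroups := fun H _ _ => by
        obtain ⟨H', _, _, ⟨e⟩⟩ :
            ∃ (H' : Type) (_ : Group H') (_ : Fintype H'), Nonempty (H ≃* H') :=
          Finite.exists_type_univ_nonempty_mulEquiv H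
        exact preservesColimitsOfShape_of_equiv e.toSingleObjEquiv.symm _
      reflectsIsos := ⟨fun f hf => by
        haveI : IsIso f.hom.hom := hf
        haveI : IsIso f.hom := inferInstance
        exact (ObjectProperty.isIso_hom_iff f).mp this⟩ }
  exact { hasFiberFunctor := ⟨_, ⟨hF⟩⟩ }

/-- NAMED FACT `bCat_galoisCategory` ([GeoAn] §1.1 p. 9; [SemiAnbd] §0 p. 6), PROVED: for a
profinite group `G`, finite sets with continuous `G`-action form a Galois category — a special
case of `galoisCategory_bCat`. [cite: MochizukiGeoAn2004, §1.1 p.9] -/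
theorem bCat_galoisCategory_holds : bCat_galoisCategory := by
  intro G _ _ _ _ _ _
  exact galoisCategory_bCat G

/-! ### Exported closure properties of continuity (appended; consumers: `OfProfiniteGroups`,
`bOf_galoisCategory`, exactness of `ContAction.res`) -/

section Exported

variable {G : Type u} [Group G] [TopologicalSpace G] [IsTopologicalGroup G]

/-- Continuity of finite `G`-sets, `Action.IsContinuous`, is closed under finite limits in
`Action FintypeCat G` (public form of the closure used for `galoisCategory_bCat`; the finite-limit
clause of "`B(G)` is a Galois category"). [cite: MochizukiGeoAn2004, §1.1 p.9] -/
theorem isClosedUnderLimitsOfShape_isContinuous (J : Type) [SmallCategory J] [FinCategory J] :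
    ObjectProperty.IsClosedUnderLimitsOfShape
      (Action.IsContinuous (V := FintypeCat.{u}) (G := G)) J :=
  ⟨fun X hX => by
    obtain ⟨h⟩ := hX
    exact isContinuous_of_isLimit h.isLimit h.prop_diag_obj⟩

/-- Continuity of finite `G`-sets is closed under finite colimits in `Action FintypeCat G` (the
finite-colimit clause of "`B(G)` is a Galois category"). [cite: MochizukiGeoAn2004, §1.1 p.9] -/
theorem isClosedUnderColimitsOfShape_isContinuous (J : Type) [SmallCategory J] [FinCategory J] :
    ObjectProperty.IsClosedUnderColimitsOfShape
      (Action.IsContinuous (V := FintypeCat.{u}) (G := G)) J :=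
  ⟨fun X hX => by
    obtain ⟨h⟩ := hX
    exact isContinuous_of_isColimit h.isColimit h.prop_diag_obj⟩

/-- Continuity of finite `G`-sets passes to subobjects: if `Z ⟶ X` is a monomorphism of
`Action FintypeCat G` and `X` is continuous then so is `Z` (the subobject clause of "`B(G)` is a
Galois category"). [cite: MochizukiGeoAn2004, §1.1 p.9] -/
theorem isContinuous_of_mono {X Z : Action FintypeCat.{u} G} (i : Z ⟶ X) [Mono i]
    (hX : Action.IsContinuous X) : Action.IsContinuous Z := by
  haveI : Mono ((forget (Action FintypeCat.{u} G)).map i) :=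
    (forget (Action FintypeCat.{u} G)).map_mono i
  exact isContinuous_of_injective i
    (ConcreteCategory.injective_of_mono_of_preservesPullback ((forget (Action FintypeCat.{u} G)).map i))
    hX

/-- A finite `G`-set is continuous iff all its stabilisers are open (public form; [SemiAnbd] §0
p. 6 "finite sets equipped with continuous `G`-action"). [cite: MochizukiSemiAnbd2006, §0 p.6] -/
theorem isContinuous_iff_stabilizer_isOpen (X : Action FintypeCat.{u} G) :
    Action.IsContinuous X ↔ ∀ x : X.V, IsOpen (MulAction.stabilizer G x : Set G) :=
  isContinuous_iff X

end Exported

end Literature.AnabelianGeometry.Anabelioids
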